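import Summits.QuantumFields.YangMills.Theorems.LuscherReductionTwistedTraceScalingSliceSmooth
import Summits.QuantumFields.YangMills.Theorems.LuscherReductionTwistedTraceScalingSliceEquiv
import Summits.QuantumFields.YangMills.Theorems.LuscherReductionTwistedTraceScalingSliceImplicit
import HarnessLib

/-!
# (N1) EVERY INNER ORBIT MEETS THE SLICE: for a tube point `orthoTube P(c) w` with `w` balanced and `‖w‖, |c|` small there is a mean-zero gauge parameter `ξ`, `‖ξ‖∞ ≤ K‖w‖∞`,
# with `gaugeCoordSq((orthoTube P(c) w)^{P∘ξ}) = 0`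
# (lane A of S-BASE, crux `TwistedTraceScaling` stmt-QuantumFields-20203, C4 INNER; design note `pub/ym-fleet/ym-luscher-20007-p1/COARSE-DESIGN.md` §23.6/§23.8 (N1))

Assembly of `…SliceSmooth` (the map `Φ̂ : (ξ, (w, c)) ↦ relLinkVec((orthoTube P(c) w)^{P∘ξ})` is strictly differentiable at `0`), `…GaugeActionCovariant` + `…CovGradInjective`
(its derivative on mean-zero `ξ` / balanced `w` is `(ξ', w', c') ↦ w' − ∇ξ'`: ★ `hasFDerivAt_sliceFn`, by the quantitative linearisation and uniqueness of the derivative),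
`…SliceEquiv` (`ξ ↦ P_Γ∇ξ` is an equivalence `{Σξ=0} ≃ Γ`) and `…SliceImplicit` (the implicit-function step):
★★★ `exists_slicePoint`: `∃ K ε > 0, ∀ w ∈ balancedSet, ∀ c, ‖w‖∞ < ε → ‖c‖∞ < ε → ∃ ξ, Σ_x ξ_x = 0 ∧ ‖ξ‖∞ ≤ K‖w‖∞ ∧ gaugeCoordSq((orthoTube P(c) w)^{P∘ξ}) = 0`.
So the Faddeev–Popov weight `N = gaugeAvg(recordWeight)` of `…RecordWeight` can be evaluated on every inner orbit AT A SLICE POINT `U*` (`P_Γ relLinkVec(U*) = 0`) within `K‖w‖ ≲ β^{-s}`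
of the tube point — the input (N1) of the Laplace evaluation (N2) (§23.8).
HONEST FRAMING: finite-dimensional calculus for a stub of a child of the CONDITIONAL reduction route R2b1; no spectral claim; C4 OPEN; not a gap, not Clay.
-/

set_option autoImplicit false

noncomputable section

open Filter Topology Real Asymptotics
open scoped BigOperators
open Literature.MathematicalPhysics.QuantumFieldTheory
open Literature.MathematicalPhysics.QuantumLattice

namespace Summit.QuantumFields.YangMills.Theorems.FemtoTransferGap.TwoLattice.ConstTube

open Summit.QuantumFields.YangMills.Theorems.FemtoTransferGap
open Summit.QuantumFields.YangMills.Theorems.FemtoTransferGap.TwoLattice.Stiff (LinkSpace)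
open Literature.Algebra.EuclideanLattices (abs_apply_le_norm)

variable (L : ℕ) [NeZero L]

/-! ## §1 The linear data: balanced stiff coordinates, the embedding into the link space, the candidate derivative -/

/-- The balanced stiff coordinates as a submodule (carrier `balancedSet`). [folklore] -/
def balancedSubmodule : Submodule ℝ (Edge 3 L → Fin 3 → ℝ) where
  carrier := balancedSet L
  add_mem' {a b} ha hb := fun k c => by
    simp only [Pi.add_apply, Finset.sum_add_distrib, ha k c, hb k c, add_zero]
  zero_mem' := fun k c => by simp
  smul_mem' r a ha := fun k c => by
    simp only [Pi.smul_apply, smul_eq_mul, ← Finset.mul_sum, ha k c, mul_zero]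

/-- A link field `w : Edge → ℝ³` as an element of the Euclidean link space. [folklore] -/
def linkEmbed : (Edge 3 L → Fin 3 → ℝ) →ₗ[ℝ] LinkSpace L where
  toFun w := WithLp.toLp 2 fun ea : Edge 3 L × Fin 3 => w ea.1 ea.2
  map_add' a b := by ext ea; rfl
  map_smul' r a := by ext ea; rfl

omit [NeZero L] in
/-- Components of `linkEmbed`. [folklore] -/
@[simp] theorem linkEmbed_apply (w : Edge 3 L → Fin 3 → ℝ) (ea : Edge 3 L × Fin 3) : linkEmbed L w ea = w ea.1 ea.2 := rfl

/-- The domain of the implicit-function step: (mean-zero `ξ`) × ((balanced `w`) × (slow coordinate `c`)). [folklore] -/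
abbrev SliceDom : Type := meanZero L × (balancedSubmodule L × (Fin 3 → Fin 3 → ℝ))

/-- The inclusion of the domain into the parameter space. [folklore] -/
def sliceIncl : SliceDom L →L[ℝ] SliceParam L :=
  (meanZero L).subtypeL.prodMap ((balancedSubmodule L).subtypeL.prodMap (ContinuousLinearMap.id ℝ (Fin 3 → Fin 3 → ℝ)))

/-- Components of the inclusion. [folklore] -/
@[simp] theorem sliceIncl_apply (h : SliceDom L) : sliceIncl L h = ((h.1 : Site 3 L → Fin 3 → ℝ), ((h.2.1 : Edge 3 L → Fin 3 → ℝ), h.2.2)) := rfl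

/-- The restricted map `Φ̂ ∘ ι`. [folklore] -/
def sliceFn (h : SliceDom L) : LinkSpace L := relLinkVec L (actCfg L (sliceIncl L h))

/-- The candidate derivative `(ξ', (w', c')) ↦ w' − ∇ξ'` on the domain. [folklore] -/
def sliceDeriv : SliceDom L →L[ℝ] LinkSpace L :=
  (LinearMap.toContinuousLinearMap (linkEmbed L ∘ₗ (balancedSubmodule L).subtype)).comp
      ((ContinuousLinearMap.fst ℝ _ _).comp (ContinuousLinearMap.snd ℝ (meanZero L) _)) -
    (LinearMap.toContinuousLinearMap (vacGrad L ∘ₗ (meanZero L).subtype)).comp (ContinuousLinearMap.fst ℝ (meanZero L) _)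

/-- Components of the candidate derivative. [folklore] -/
theorem sliceDeriv_apply (h : SliceDom L) : sliceDeriv L h = linkEmbed L (h.2.1 : Edge 3 L → Fin 3 → ℝ) - vacGrad L (h.1 : Site 3 L → Fin 3 → ℝ) := rfl

/-! ## §2 The quadratic remainder bound and the derivative of `Φ̂ ∘ ι` at `0` -/

/-- ★ **Quadratic remainder**: for `‖h‖ ≤ 1/40`, `‖Φ̂(ι h) − (w − ∇ξ)‖ ≤ 2652·√(3|E|)·‖h‖²`. [folklore] -/
theorem norm_sliceFn_sub_sliceDeriv_le (h : SliceDom L) (hh : ‖h‖ ≤ 1 / 40) :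
    ‖sliceFn L h - sliceDeriv L h‖ ≤ 2652 * Real.sqrt (3 * Fintype.card (Edge 3 L)) * ‖h‖ ^ 2 := by
  set ξ : Site 3 L → Fin 3 → ℝ := (h.1 : Site 3 L → Fin 3 → ℝ) with hξdef
  set w : Edge 3 L → Fin 3 → ℝ := (h.2.1 : Edge 3 L → Fin 3 → ℝ) with hwdef
  set c : Fin 3 → Fin 3 → ℝ := h.2.2 with hcdef
  set u : GaugeConfig 3 1 SU2 := fun e₁ => chartSU2 (c e₁.2) with hudef
  have hξn : ‖ξ‖ ≤ ‖h‖ := norm_fst_le h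
  have hwn : ‖w‖ ≤ ‖h‖ := (norm_fst_le h.2).trans (norm_snd_le h)
  have hcn : ‖c‖ ≤ ‖h‖ := (norm_snd_le h.2).trans (norm_snd_le h)
  have h0 : 0 ≤ ‖h‖ := norm_nonneg h
  have hG : ∀ x, ‖ξ x‖ ≤ ‖h‖ := fun x => (norm_le_pi_norm ξ x).trans hξn
  have hω : ∀ e, ‖w e‖ ≤ ‖h‖ := fun e => (norm_le_pi_norm w e).trans hwn
  have hbal : ∀ (k : Fin 3) (a : Fin 3), ∑ x : Site 3 L, w (x, k) a = 0 := h.2.1.2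
  have hmean : ∑ x : Site 3 L, ξ x = 0 := h.1.2
  -- per link, sup over components: linearisation at slow variable `u`
  have hlin : ∀ e : Edge 3 L, ‖(fun a => relLinkVec L (gaugeTransform (fun x => chartSU2 (ξ x)) (orthoTube L u w)) (e, a)) - (w e - covGrad L u ξ e)‖ ≤
      2640 * ‖h‖ ^ 2 := fun e => by
    have h1 := norm_relLinkVec_gaugeTransform_orthoTube_sub_le (u := u) hG hω hh (by linarith) hbal hmean e
    calc _ ≤ 440 * (4 * ‖h‖ ^ 2 + 2 * ‖h‖ * ‖h‖) := h1
      _ = 2640 * ‖h‖ ^ 2 := by ring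
  -- covariant vs vacuum gradient
  have hcτ : ∀ (k : Fin 3) (b : Fin 3), |vecPart (u (0, k)) b| ≤ ‖h‖ := fun k b => by
    have hc1 : ∑ a, c k a ^ 2 ≤ 1 := by
      have h3 := sum_sq_le_three_norm_sq (c k)
      have hck : ‖c k‖ ≤ 1 / 40 := ((norm_le_pi_norm c k).trans hcn).trans hh
      nlinarith [norm_nonneg (c k)]
    show |vecPart (chartSU2 (c k)) b| ≤ ‖h‖
    rw [vecPart_chartSU2 hc1]
    exact ((abs_apply_le_norm (c k) b).trans (norm_le_pi_norm c k)).trans hcn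
  have hcov : ∀ (e : Edge 3 L) (a : Fin 3), |(covGrad L u ξ e - (ξ (e.1.shift e.2) - ξ e.1)) a| ≤ 12 * ‖h‖ ^ 2 := fun e a => by
    have hform : (covGrad L u ξ e - (ξ (e.1.shift e.2) - ξ e.1)) a = ((adRot (u (0, e.2)) - 1).mulVec (ξ (e.1.shift e.2))) a := by
      simp only [covGrad, Pi.sub_apply, Matrix.sub_mulVec, Matrix.one_mulVec]; ring
    rw [hform]
    calc _ ≤ 12 * ‖h‖ * ‖ξ (e.1.shift e.2)‖ := abs_adRot_sub_one_mulVec_le _ (by linarith) (hcτ e.2) _ a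
      _ ≤ 12 * ‖h‖ * ‖h‖ := mul_le_mul_of_nonneg_left (hG _) (by positivity)
      _ = 12 * ‖h‖ ^ 2 := by ring
  -- componentwise bound of the difference
  have hcomp : ∀ ea : Edge 3 L × Fin 3, |(sliceFn L h - sliceDeriv L h) ea| ≤ 2652 * ‖h‖ ^ 2 := fun ea => by
    have hval : (sliceFn L h - sliceDeriv L h) ea =
        ((fun a => relLinkVec L (gaugeTransform (fun x => chartSU2 (ξ x)) (orthoTube L u w)) (ea.1, a)) - (w ea.1 - covGrad L u ξ ea.1)) ea.2 -
          (covGrad L u ξ ea.1 - (ξ (ea.1.1.shift ea.1.2) - ξ ea.1.1)) ea.2 := by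
      rw [WithLp.ofLp_sub, Pi.sub_apply, sliceDeriv_apply, WithLp.ofLp_sub, Pi.sub_apply, linkEmbed_apply,
        show ea = (ea.1, ea.2) from rfl, vacGrad_apply]
      simp only [sliceFn, actCfg, sliceIncl_apply, Pi.sub_apply]
      ring
    rw [hval]
    have h1 : |((fun a => relLinkVec L (gaugeTransform (fun x => chartSU2 (ξ x)) (orthoTube L u w)) (ea.1, a)) - (w ea.1 - covGrad L u ξ ea.1)) ea.2| ≤
        2640 * ‖h‖ ^ 2 := by
      have := abs_apply_le_norm ((fun a => relLinkVec L (gaugeTransform (fun x => chartSU2 (ξ x)) (orthoTube L u w)) (ea.1, a)) - (w ea.1 - covGrad L u ξ ea.1)) ea.2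
      exact this.trans (hlin ea.1)
    have h2 := hcov ea.1 ea.2
    calc _ ≤ |((fun a => relLinkVec L (gaugeTransform (fun x => chartSU2 (ξ x)) (orthoTube L u w)) (ea.1, a)) - (w ea.1 - covGrad L u ξ ea.1)) ea.2| +
          |(covGrad L u ξ ea.1 - (ξ (ea.1.1.shift ea.1.2) - ξ ea.1.1)) ea.2| := abs_sub _ _
      _ ≤ 2640 * ‖h‖ ^ 2 + 12 * ‖h‖ ^ 2 := add_le_add h1 h2
      _ = 2652 * ‖h‖ ^ 2 := by ring
  -- Euclidean norm
  have hsq : ‖sliceFn L h - sliceDeriv L h‖ ^ 2 ≤ (2652 * Real.sqrt (3 * Fintype.card (Edge 3 L)) * ‖h‖ ^ 2) ^ 2 := by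
    rw [EuclideanSpace.norm_sq_eq]
    calc ∑ ea, ‖(sliceFn L h - sliceDeriv L h) ea‖ ^ 2 ≤ ∑ _ea : Edge 3 L × Fin 3, (2652 * ‖h‖ ^ 2) ^ 2 :=
          Finset.sum_le_sum fun ea _ => by
            rw [Real.norm_eq_abs]; exact pow_le_pow_left₀ (abs_nonneg _) (hcomp ea) 2
      _ = (3 * Fintype.card (Edge 3 L)) * (2652 * ‖h‖ ^ 2) ^ 2 := by
          rw [Finset.sum_const, Finset.card_univ, nsmul_eq_mul, Fintype.card_prod, Fintype.card_fin]; push_cast; ring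
      _ = (2652 * Real.sqrt (3 * Fintype.card (Edge 3 L)) * ‖h‖ ^ 2) ^ 2 := by
          rw [show (2652 * Real.sqrt (3 * Fintype.card (Edge 3 L)) * ‖h‖ ^ 2) ^ 2 = Real.sqrt (3 * Fintype.card (Edge 3 L)) ^ 2 * (2652 * ‖h‖ ^ 2) ^ 2 by ring,
            Real.sq_sqrt (by positivity)]
  exact (abs_le_of_sq_le_sq' hsq (by positivity)).2

/-- `Φ̂(ι 0) = 0`. [folklore] -/
theorem sliceFn_zero : sliceFn L 0 = 0 := by
  simp only [sliceFn, map_zero]; exact relLinkVec_actCfg_zero L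

/-- ★ **The derivative of `Φ̂ ∘ ι` at `0` is `(ξ', (w', c')) ↦ w' − ∇ξ'`.** [folklore] -/
theorem hasFDerivAt_sliceFn : HasFDerivAt (sliceFn L) (sliceDeriv L) 0 := by
  rw [hasFDerivAt_iff_isLittleO_nhds_zero]
  simp only [sliceFn_zero, sub_zero, zero_add]
  refine isLittleO_iff.mpr fun ε hε => ?_
  set M : ℝ := 2652 * Real.sqrt (3 * Fintype.card (Edge 3 L)) with hM
  have hM0 : 0 < M := by
    rw [hM]; have : (0 : ℝ) < Fintype.card (Edge 3 L) := by exact_mod_cast Fintype.card_pos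
    positivity
  have hball : Metric.closedBall (0 : SliceDom L) (min (1 / 40) (ε / M)) ∈ 𝓝 (0 : SliceDom L) :=
    Metric.closedBall_mem_nhds 0 (lt_min (by norm_num) (div_pos hε hM0))
  filter_upwards [hball] with h hh
  rw [Metric.mem_closedBall, dist_zero_right] at hh
  have h1 := norm_sliceFn_sub_sliceDeriv_le L h (hh.trans (min_le_left _ _))
  have h2 : M * ‖h‖ ≤ ε := by
    have := hh.trans (min_le_right _ _)
    rwa [le_div_iff₀ hM0, mul_comm] at this
  calc ‖sliceFn L h - sliceDeriv L h‖ ≤ M * ‖h‖ ^ 2 := h1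
    _ = (M * ‖h‖) * ‖h‖ := by ring
    _ ≤ ε * ‖h‖ := mul_le_mul_of_nonneg_right h2 (norm_nonneg _)

/-- ★ **`Φ̂ ∘ ι` is strictly differentiable at `0` with derivative `(ξ', (w', c')) ↦ w' − ∇ξ'`** (strictness from `…SliceSmooth`, the value by uniqueness). [folklore] -/
theorem hasStrictFDerivAt_sliceFn : HasStrictFDerivAt (sliceFn L) (sliceDeriv L) 0 := by
  have hstrict : HasStrictFDerivAt (sliceFn L) ((fderiv ℝ (fun z => relLinkVec L (actCfg L z)) 0).comp (sliceIncl L)) 0 := by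
    have h := hasStrictFDerivAt_relLinkVec_actCfg L
    have h0 : sliceIncl L 0 = 0 := map_zero _
    rw [← h0] at h
    exact h.comp 0 (sliceIncl L).hasStrictFDerivAt
  have heq : (fderiv ℝ (fun z => relLinkVec L (actCfg L z)) 0).comp (sliceIncl L) = sliceDeriv L := hstrict.hasFDerivAt.unique (hasFDerivAt_sliceFn L)
  rwa [heq] at hstrict

/-! ## §3 ★★★ Every inner orbit meets the slice -/

omit [NeZero L] in
/-- `P(0) = 1`. [folklore] -/
theorem chartSU2_zero' : chartSU2 (0 : Fin 3 → ℝ) = 1 := by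
  have h0 : ∑ a, (0 : Fin 3 → ℝ) a ^ 2 ≤ 1 := by simp
  refine eq_of_scalarPart_eq_of_vecPart_eq ?_ ?_
  · rw [scalarPart_chartSU2 h0, PolyakovLift.scalarPart_one]; simp
  · rw [vecPart_chartSU2 h0, PolyakovLift.vecPart_one]

/-- The relative coordinate of the vacuum configuration vanishes. [folklore] -/
theorem relLinkVec_one : relLinkVec L (1 : GaugeConfig 3 L SU2) = 0 := by
  have h := relLinkVec_actCfg_zero L
  have hact : actCfg L 0 = 1 := by
    funext e; rw [actCfg_apply]; simp [chartSU2_zero']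
  rwa [hact] at h

/-- The relative coordinate of a constant configuration vanishes. [folklore] -/
theorem relLinkVec_constLift (u : GaugeConfig 3 1 SU2) : relLinkVec L (constLift L u) = 0 := by
  have hD : ∀ k : Fin 3, dirQuat L k (1 : GaugeConfig 3 L SU2) ≠ 0 := fun k => by
    rw [dirQuat_eq_sum_su2Quat]
    simp only [Pi.one_apply, Balaban1983to89.T4HaarSU2Translate.su2Quat_one, Finset.sum_const, Finset.card_univ]
    rw [← Nat.cast_smul_eq_nsmul ℝ, smul_ne_zero_iff]
    exact ⟨by exact_mod_cast Fintype.card_ne_zero, one_ne_zero⟩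
  have h := relLinkVec_mul_constLift L 1 u hD
  rwa [one_mul, relLinkVec_one] at h

/-- The slow-only points are fixed: `Φ̂(0, (0, c)) = 0`. [folklore] -/
theorem sliceFn_zero_zero (c : Fin 3 → Fin 3 → ℝ) : sliceFn L (0, (0, c)) = 0 := by
  have hact : actCfg L (sliceIncl L (0, (0, c))) = constLift L (fun e₁ => chartSU2 (c e₁.2)) := by
    funext e
    rw [actCfg_apply, sliceIncl_apply, constLift_apply]
    simp [chartSU2_zero']
  rw [sliceFn, hact, relLinkVec_constLift]

/-- ★★★ **(N1) EVERY INNER ORBIT MEETS THE SLICE, QUANTITATIVELY**: there are `K ≥ 0` and `ε > 0` (depending on `L` only) such that for every balanced stiff coordinate `w` and slow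
coordinate `c` with `‖w‖∞, ‖c‖∞ < ε` there is a mean-zero gauge parameter `ξ` with `‖ξ‖∞ ≤ K‖w‖∞` and `gaugeCoordSq((orthoTube P(c) w)^{P∘ξ}) = 0` — the based gauge orbit of the
tube point meets the slice `P_Γ relLinkVec = 0` within `K‖w‖` of the point. [folklore] -/
theorem exists_slicePoint : ∃ K ε : ℝ, 0 ≤ K ∧ 0 < ε ∧ ∀ w : Edge 3 L → Fin 3 → ℝ, w ∈ balancedSet L → ∀ c : Fin 3 → Fin 3 → ℝ, ‖w‖ < ε → ‖c‖ < ε →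
    ∃ ξ : Site 3 L → Fin 3 → ℝ, ∑ x : Site 3 L, ξ x = 0 ∧ ‖ξ‖ ≤ K * ‖w‖ ∧
      gaugeCoordSq L (gaugeTransform (fun x => chartSU2 (ξ x)) (orthoTube L (fun e₁ => chartSU2 (c e₁.2)) w)) = 0 := by
  -- the data of the implicit-function step
  set P := (gaugeModes L).orthogonalProjectionOnto with hP
  set f : SliceDom L → gaugeModes L := fun h => P (sliceFn L h) with hf
  set A : meanZero L ≃L[ℝ] gaugeModes L := (sliceEquiv L (one_mem_sliceRadius L)).trans (ContinuousLinearEquiv.neg ℝ) with hA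
  set B : balancedSubmodule L →L[ℝ] gaugeModes L := P.comp (LinearMap.toContinuousLinearMap (linkEmbed L ∘ₗ (balancedSubmodule L).subtype)) with hB
  set T : SliceDom L →L[ℝ] gaugeModes L :=
    (A : meanZero L →L[ℝ] gaugeModes L).comp (ContinuousLinearMap.fst ℝ (meanZero L) (balancedSubmodule L × (Fin 3 → Fin 3 → ℝ))) +
      B.comp ((ContinuousLinearMap.fst ℝ (balancedSubmodule L) (Fin 3 → Fin 3 → ℝ)).comp
        (ContinuousLinearMap.snd ℝ (meanZero L) (balancedSubmodule L × (Fin 3 → Fin 3 → ℝ)))) with hT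
  have hderiv : P.comp (sliceDeriv L) = T := by
    refine ContinuousLinearMap.ext fun h => Subtype.ext ?_
    have hPξ : ((P (vacGrad L (h.1 : Site 3 L → Fin 3 → ℝ)) : gaugeModes L) : LinkSpace L) = vacGrad L (h.1 : Site 3 L → Fin 3 → ℝ) := by
      rw [hP, Submodule.coe_orthogonalProjectionOnto_apply, proj_vacGrad]
    have hA1 : (A : meanZero L →L[ℝ] gaugeModes L) h.1 = -(sliceEquiv L (one_mem_sliceRadius L) h.1) := rfl
    have hAξ : (((A : meanZero L →L[ℝ] gaugeModes L) h.1 : gaugeModes L) : LinkSpace L) = -vacGrad L (h.1 : Site 3 L → Fin 3 → ℝ) := by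
      rw [hA1, Submodule.coe_neg, sliceEquiv_apply, coe_sliceMap_one]
    have hBw : ((B h.2.1 : gaugeModes L) : LinkSpace L) = ((P (linkEmbed L (h.2.1 : Edge 3 L → Fin 3 → ℝ)) : gaugeModes L) : LinkSpace L) := rfl
    have lhs : (((P.comp (sliceDeriv L)) h : gaugeModes L) : LinkSpace L) =
        ((P (linkEmbed L (h.2.1 : Edge 3 L → Fin 3 → ℝ)) : gaugeModes L) : LinkSpace L) - vacGrad L (h.1 : Site 3 L → Fin 3 → ℝ) := by
      rw [ContinuousLinearMap.comp_apply, sliceDeriv_apply, map_sub, Submodule.coe_sub, hPξ]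
    have rhs : ((T h : gaugeModes L) : LinkSpace L) =
        -vacGrad L (h.1 : Site 3 L → Fin 3 → ℝ) + ((P (linkEmbed L (h.2.1 : Edge 3 L → Fin 3 → ℝ)) : gaugeModes L) : LinkSpace L) := by
      show ((((A : meanZero L →L[ℝ] gaugeModes L) h.1 + B h.2.1 : gaugeModes L)) : LinkSpace L) = _
      rw [Submodule.coe_add, hAξ, hBw]
    rw [lhs, rhs]; abel
  have hfd : HasStrictFDerivAt f T (0, (0, 0)) := by
    rw [← hderiv]
    exact P.hasStrictFDerivAt.comp (0, (0, 0)) (hasStrictFDerivAt_sliceFn L)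
  have h0 : ∀ᶠ c in 𝓝 (0 : Fin 3 → Fin 3 → ℝ), f (0, (0, c)) = 0 := Filter.Eventually.of_forall fun c => by
    rw [hf]; simp only [sliceFn_zero_zero, map_zero]
  obtain ⟨K, ε, hK, hε, hsol⟩ := exists_zero_near_of_hasStrictFDerivAt f A B hfd h0
  refine ⟨K, ε, hK, hε, fun w hw c hwn hcn => ?_⟩
  obtain ⟨e, he0, heK⟩ := hsol ⟨w, hw⟩ c hwn hcn
  refine ⟨e, e.2, heK, ?_⟩
  -- `P (sliceFn (e, (w, c))) = 0` ⇒ the squared gauge coordinate vanishes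
  have hproj : (gaugeModes L).starProjection (relLinkVec L (actCfg L (sliceIncl L (e, (⟨w, hw⟩, c))))) = 0 := by
    have := congrArg (fun v : gaugeModes L => (v : LinkSpace L)) he0
    simpa [hf, hP, sliceFn] using this
  unfold gaugeCoordSq
  rw [show gaugeTransform (fun x => chartSU2 ((e : Site 3 L → Fin 3 → ℝ) x)) (orthoTube L (fun e₁ => chartSU2 (c e₁.2)) w) =
      actCfg L (sliceIncl L (e, (⟨w, hw⟩, c))) from rfl, hproj, norm_zero, zero_pow two_ne_zero]

end Summit.QuantumFields.YangMills.Theorems.FemtoTransferGap.TwoLattice.ConstTube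

end
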